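import Mathlib
import Literature.Analysis.FunctionSpaces.FlatTorusProofs
import Literature.Analysis.FunctionSpaces.TorusVerticalLift
import Summits.AnomalousDissipation.AnomalousDissipation.Theorems.DyadicWallCascadeDyadicRealisationLerayCappingTools
import HarnessLib

/-!
# Leray capping, tools IV: horizontally periodic functions on `ℝ³` read on the torus, and the
# divergence theorem on a periodic box

Tools file for `stub_lerayCapping` of
`Summit.AnomalousDissipation.AnomalousDissipation.Theses.DyadicWallCascade.DyadicRealisation`
(line Sketch):

* `lerayCapping_comp_repr_proj` — for `G : ℝ³ → ℝ³` that is `1`-periodic in `Y₀, Y₁`,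
  `G (repr (proj Y)) = G (Y − ⌊Y₂⌋ e₂)`;
* `lerayCapping_contDiff_comp_repr_proj` — if moreover `G` is smooth and vanishes near the planes
  `Y₂ ∈ {0, 1}`, then `Y ↦ G (repr (proj Y))` (the lift of `G ∘ repr`) is smooth on `ℝ³`;
* `lerayCapping_setIntegral_unitCube_eq_box` — a cube integral of a function vanishing near the
  horizontal faces is a box integral in the coordinates `Fin 3 → ℝ`;
* `lerayCapping_setIntegral_fin_two` — `∫_{[0,1]²} K = ∫_{[0,1]×[0,1]} K(q₁, q₂)`;
* `lerayCapping_box_divergence` — the divergence theorem on `[0,1]² × [a,b]` for fields that are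
  `1`-periodic in the two horizontal directions: only the top and bottom faces contribute.

The file ends with the registered tools stub `stub_lerayCappingTools4`.
-/

open Set Function MeasureTheory Filter Topology
open Literature.Analysis.FunctionSpaces
open scoped BigOperators ContDiff

set_option linter.dupNamespace false

namespace Summit.AnomalousDissipation.AnomalousDissipation.Theorems

/-- **The representative of a horizontally periodic function.** If `G : ℝ³ → ℝ³` is `1`-periodic
in `Y₀` and `Y₁`, then `G (repr (proj Y)) = G (Y − ⌊Y₂⌋ e₂)`. [folklore] -/
theorem lerayCapping_comp_repr_proj (G : EuclideanSpace ℝ (Fin 3) → EuclideanSpace ℝ (Fin 3))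
    (h0 : ∀ Y : EuclideanSpace ℝ (Fin 3), G (Y + EuclideanSpace.single 0 (1 : ℝ)) = G Y)
    (h1 : ∀ Y : EuclideanSpace ℝ (Fin 3), G (Y + EuclideanSpace.single 1 (1 : ℝ)) = G Y)
    (Y : EuclideanSpace ℝ (Fin 3)) :
    G (Torus.repr (Torus.proj Y)) = G (Y - (⌊Y 2⌋ : ℝ) • EuclideanSpace.single 2 (1 : ℝ)) := by
  have hrepr : Torus.repr (Torus.proj Y) =
      Y - (⌊Y 2⌋ : ℝ) • EuclideanSpace.single 2 (1 : ℝ) +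
        ((-⌊Y 0⌋ : ℤ) : ℝ) • EuclideanSpace.single 0 (1 : ℝ) +
        ((-⌊Y 1⌋ : ℤ) : ℝ) • EuclideanSpace.single 1 (1 : ℝ) := by
    rw [Torus.repr_proj_eq]
    ext i
    fin_cases i <;> simp <;> rw [Int.fract] <;> ring
  obtain ⟨-, -, -, hshift, -⟩ := stub_lerayCappingTools
  rw [hrepr, hshift G (fun _ => True) _ (by simp) (fun X _ => h1 X) _ _ trivial,
    hshift G (fun _ => True) _ (by simp) (fun X _ => h0 X) _ _ trivial]

/-- **Smoothness of the lift of a horizontally periodic function vanishing near the wall.** If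
`G : ℝ³ → ℝ³` is smooth, `1`-periodic in `Y₀, Y₁`, and `G Y = 0` whenever `Y₂ ≤ δ` or
`1 − δ ≤ Y₂` (`δ > 0`), then `Y ↦ G (repr (proj Y))` is smooth on `ℝ³`: near a point whose
vertical fractional part is away from `0, 1` it is a vertical integer translate of `G`, near the
other points it vanishes identically. [folklore] -/
theorem lerayCapping_contDiff_comp_repr_proj
    (G : EuclideanSpace ℝ (Fin 3) → EuclideanSpace ℝ (Fin 3))
    (hG : ContDiff ℝ ((⊤ : ℕ∞) : WithTop ℕ∞) G)
    (h0 : ∀ Y : EuclideanSpace ℝ (Fin 3), G (Y + EuclideanSpace.single 0 (1 : ℝ)) = G Y)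
    (h1 : ∀ Y : EuclideanSpace ℝ (Fin 3), G (Y + EuclideanSpace.single 1 (1 : ℝ)) = G Y)
    (δ : ℝ) (hδ : 0 < δ)
    (hz : ∀ Y : EuclideanSpace ℝ (Fin 3), (Y 2 ≤ δ ∨ 1 - δ ≤ Y 2) → G Y = 0) :
    ContDiff ℝ ((⊤ : ℕ∞) : WithTop ℕ∞)
      (fun Y : EuclideanSpace ℝ (Fin 3) => G (Torus.repr (Torus.proj Y))) := by
  set e2 : EuclideanSpace ℝ (Fin 3) := EuclideanSpace.single 2 (1 : ℝ) with he2
  set P : EuclideanSpace ℝ (Fin 3) → EuclideanSpace ℝ (Fin 3) := fun Y => Y - (⌊Y 2⌋ : ℝ) • e2 with hP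
  have hPeq : ∀ Y, G (Torus.repr (Torus.proj Y)) = G (P Y) := fun Y =>
    lerayCapping_comp_repr_proj G h0 h1 Y
  have hP2 : ∀ Y, P Y 2 = Int.fract (Y 2) := fun Y => by
    simp [hP, he2]
  simp_rw [hPeq]
  refine contDiff_iff_contDiffAt.2 fun y₀ => ?_
  have hcoord : Continuous fun Y : EuclideanSpace ℝ (Fin 3) => Y 2 := PiLp.continuous_apply 2 _ 2
  have hnear : ∀ᶠ Y in 𝓝 y₀, |Y 2 - y₀ 2| < δ / 2 :=
    (hcoord.continuousAt.eventually (Metric.ball_mem_nhds (y₀ 2) (half_pos hδ))).mono fun Y hY => by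
      simpa [Real.dist_eq] using hY
  by_cases hgood : δ / 2 < Int.fract (y₀ 2) ∧ Int.fract (y₀ 2) < 1 - δ / 2
  · -- near `y₀` the floor of the vertical coordinate is constant
    have hfl : ∀ᶠ Y in 𝓝 y₀, (⌊Y 2⌋ : ℝ) = ⌊y₀ 2⌋ := by
      filter_upwards [hnear] with Y hY
      have hab := abs_lt.1 hY
      have hf0 := Int.floor_le (y₀ 2)
      have hf1 := Int.lt_floor_add_one (y₀ 2)
      rw [Int.fract] at hgood
      have : ⌊Y 2⌋ = ⌊y₀ 2⌋ := Int.floor_eq_iff.2 ⟨by push_cast; linarith, by push_cast; linarith⟩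
      exact_mod_cast this
    have hloc : ∀ᶠ Y in 𝓝 y₀, P Y = Y - (⌊y₀ 2⌋ : ℝ) • e2 := by
      filter_upwards [hfl] with Y hY
      simp only [hP, hY]
    have hsm : ContDiffAt ℝ ((⊤ : ℕ∞) : WithTop ℕ∞) (fun Y => G (Y - (⌊y₀ 2⌋ : ℝ) • e2)) y₀ :=
      (hG.comp (contDiff_id.sub contDiff_const)).contDiffAt
    exact hsm.congr_of_eventuallyEq (hloc.mono fun Y hY => by simp only [hY])
  · -- near `y₀` the function vanishes
    have key : ∀ᶠ Y in 𝓝 y₀, Int.fract (Y 2) ≤ δ ∨ 1 - δ ≤ Int.fract (Y 2) := by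
      have hi : Int.fract (y₀ 2) ≤ δ / 2 ∨ 1 - δ / 2 ≤ Int.fract (y₀ 2) := by
        by_contra hcon
        rw [not_or, not_le, not_le] at hcon
        exact hgood ⟨hcon.1, hcon.2⟩
      filter_upwards [hnear] with Y hY
      have hab := abs_lt.1 hY
      by_contra hcon
      rw [not_or, not_le, not_le] at hcon
      have hy0 := Int.floor_le (Y 2)
      have hy1 := Int.lt_floor_add_one (Y 2)
      have hfy : Int.fract (Y 2) = Y 2 - ⌊Y 2⌋ := rfl
      rw [hfy] at hcon
      have hflr : ⌊y₀ 2⌋ = ⌊Y 2⌋ := Int.floor_eq_iff.2 ⟨by push_cast; linarith, by push_cast; linarith⟩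
      have hfy0 : Int.fract (y₀ 2) = y₀ 2 - ⌊Y 2⌋ := by rw [Int.fract, hflr]
      rw [hfy0] at hi
      rcases hi with hi | hi <;> linarith
    have hzero : ∀ᶠ Y in 𝓝 y₀, G (P Y) = 0 := by
      filter_upwards [key] with Y hY
      refine hz _ ?_
      rw [hP2]
      exact hY
    exact (contDiffAt_const (c := (0 : EuclideanSpace ℝ (Fin 3)))).congr_of_eventuallyEq hzero

/-- The two layers next to the wall: for `0 ≤ Y₂ < 1` the representative is `Y` itself, for
`-1 ≤ Y₂ < 0` it is `Y + e₂` (horizontally periodic `G`). [folklore] -/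
theorem lerayCapping_comp_repr_proj_layers (G : EuclideanSpace ℝ (Fin 3) → EuclideanSpace ℝ (Fin 3))
    (h0 : ∀ Y : EuclideanSpace ℝ (Fin 3), G (Y + EuclideanSpace.single 0 (1 : ℝ)) = G Y)
    (h1 : ∀ Y : EuclideanSpace ℝ (Fin 3), G (Y + EuclideanSpace.single 1 (1 : ℝ)) = G Y)
    (Y : EuclideanSpace ℝ (Fin 3)) :
    (0 ≤ Y 2 → Y 2 < 1 → G (Torus.repr (Torus.proj Y)) = G Y) ∧
    (-1 ≤ Y 2 → Y 2 < 0 →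
      G (Torus.repr (Torus.proj Y)) = G (Y + EuclideanSpace.single 2 (1 : ℝ))) := by
  refine ⟨fun ha hb => ?_, fun ha hb => ?_⟩
  · rw [lerayCapping_comp_repr_proj G h0 h1 Y]
    have : ⌊Y 2⌋ = 0 := Int.floor_eq_iff.2 ⟨by simpa using ha, by simpa using hb⟩
    simp [this]
  · rw [lerayCapping_comp_repr_proj G h0 h1 Y]
    have : ⌊Y 2⌋ = -1 := Int.floor_eq_iff.2 ⟨by simpa using ha, by push_cast; linarith⟩
    simp [this]

/-- A vector integral on the torus vanishes when all its coordinate integrals do. [folklore] -/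
theorem lerayCapping_integral_eq_zero_of_forall_apply
    (h : UnitAddTorus (Fin 3) → EuclideanSpace ℝ (Fin 3)) (hh : Integrable h)
    (hz : ∀ j : Fin 3, ∫ x, h x j = 0) : ∫ x, h x = 0 := by
  ext j
  have := (EuclideanSpace.proj j : EuclideanSpace ℝ (Fin 3) →L[ℝ] ℝ).integral_comp_comm hh
  simp only [PiLp.zero_apply]
  rw [← hz j]
  exact this.symm

/-- **Cube integrals as box integrals.** For `G : ℝ³ → F` vanishing on the part of the unit cube
below height `a` and above height `b` (`0 ≤ a ≤ b ≤ 1`), the integral over the half-open unit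
cube `[0,1)³` is the integral of `G ∘ toLp` over the closed box `[0,1]² × [a,b] ⊂ (Fin 3 → ℝ)`.
[folklore] -/
theorem lerayCapping_setIntegral_unitCube_eq_box {F : Type*} [NormedAddCommGroup F]
    [NormedSpace ℝ F] (G : EuclideanSpace ℝ (Fin 3) → F) (a b : ℝ) (ha : 0 ≤ a) (hb : b ≤ 1)
    (hz : ∀ Y : EuclideanSpace ℝ (Fin 3), 0 ≤ Y 2 → Y 2 ≤ 1 → (Y 2 < a ∨ b < Y 2) → G Y = 0) :
    ∫ Y in Torus.unitCube (Fin 3), G Y =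
      ∫ x in Icc (![0, 0, a] : Fin 3 → ℝ) ![1, 1, b], G (WithLp.toLp 2 x) := by
  -- to the coordinates `Fin 3 → ℝ`
  have h1 := (PiLp.volume_preserving_toLp (Fin 3)).setIntegral_preimage_emb
    (MeasurableEquiv.toLp 2 (Fin 3 → ℝ)).measurableEmbedding G (Torus.unitCube (Fin 3))
  have hpre : (WithLp.toLp 2 : (Fin 3 → ℝ) → EuclideanSpace ℝ (Fin 3)) ⁻¹' Torus.unitCube (Fin 3) =
      Set.pi univ fun _ => Ico (0 : ℝ) 1 := by
    ext x; simp [Torus.unitCube]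
  rw [← h1]
  change ∫ x in (WithLp.toLp 2 : (Fin 3 → ℝ) → EuclideanSpace ℝ (Fin 3)) ⁻¹' Torus.unitCube (Fin 3),
    G (WithLp.toLp 2 x) = _
  rw [hpre, volume_pi, setIntegral_congr_set Measure.univ_pi_Ico_ae_eq_Icc, ← volume_pi]
  -- shrink the closed unit cube to the box
  refine setIntegral_eq_of_subset_of_forall_sdiff_eq_zero measurableSet_Icc (Icc_subset_Icc ?_ ?_)
    fun x hx => ?_
  · intro i; fin_cases i <;> simp [ha]
  · intro i; fin_cases i <;> simp [hb]
  · obtain ⟨hx1, hx2⟩ := hx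
    rw [mem_Icc, Pi.le_def, Pi.le_def] at hx1
    have h0 := hx1.1 2; have h1' := hx1.2 2
    refine hz _ (by simpa using h0) (by simpa using h1') ?_
    by_contra hcon
    rw [not_or, not_lt, not_lt] at hcon
    apply hx2
    rw [mem_Icc, Pi.le_def, Pi.le_def]
    constructor
    · intro i
      fin_cases i
      · simpa using hx1.1 0
      · simpa using hx1.1 1
      · simpa using hcon.1
    · intro i
      fin_cases i
      · simpa using hx1.2 0
      · simpa using hx1.2 1
      · simpa using hcon.2

/-- **Square integrals in two spellings**: `∫_{[0,1]²} K = ∫_{[0,1]×[0,1]} K(q₁,q₂)` for the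
coordinates `Fin 2 → ℝ` versus `ℝ × ℝ`. [folklore] -/
theorem lerayCapping_setIntegral_fin_two {F : Type*} [NormedAddCommGroup F] [NormedSpace ℝ F]
    (K : (Fin 2 → ℝ) → F) :
    ∫ x in Icc (0 : Fin 2 → ℝ) 1, K x = ∫ q in Icc (0 : ℝ) 1 ×ˢ Icc (0 : ℝ) 1, K ![q.1, q.2] := by
  have h := (volume_preserving_finTwoArrow ℝ).setIntegral_preimage_emb
    (MeasurableEquiv.finTwoArrow (α := ℝ)).measurableEmbedding (fun q : ℝ × ℝ => K ![q.1, q.2])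
    (Icc (0 : ℝ) 1 ×ˢ Icc (0 : ℝ) 1)
  rw [← h]
  have hpre : (MeasurableEquiv.finTwoArrow (α := ℝ)) ⁻¹' (Icc (0 : ℝ) 1 ×ˢ Icc (0 : ℝ) 1) =
      Icc (0 : Fin 2 → ℝ) 1 := by
    ext x
    simp [Pi.le_def, Fin.forall_fin_two]
  rw [hpre]
  refine setIntegral_congr_fun measurableSet_Icc fun x _ => ?_
  congr 1
  funext i
  fin_cases i <;> simp

/-- **The divergence theorem on a horizontally periodic box.** Let `φ₀, φ₁, φ₂ : ℝ³ → ℝ` be `C¹` on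
the open layer `{0 < Y₂ < 1}`, with `φ₀` `1`-periodic in `Y₀` and `φ₁` `1`-periodic in `Y₁`, and
let `0 < a ≤ b < 1`.  Then `∫_{[0,1]²×[a,b]} (∂₀φ₀ + ∂₁φ₁ + ∂₂φ₂)` equals
`∫_{[0,1]²} φ₂(·,·,b) − ∫_{[0,1]²} φ₂(·,·,a)`: the lateral faces cancel by periodicity
(Mathlib's divergence theorem on boxes). [folklore] -/
theorem lerayCapping_box_divergence (φ : Fin 3 → EuclideanSpace ℝ (Fin 3) → ℝ) (a b : ℝ)
    (ha : 0 < a) (hab : a ≤ b) (hb : b < 1)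
    (hφ : ∀ i, ContDiffOn ℝ 1 (φ i) {Y : EuclideanSpace ℝ (Fin 3) | 0 < Y 2 ∧ Y 2 < 1})
    (h0 : ∀ Y : EuclideanSpace ℝ (Fin 3), φ 0 (Y + EuclideanSpace.single 0 (1 : ℝ)) = φ 0 Y)
    (h1 : ∀ Y : EuclideanSpace ℝ (Fin 3), φ 1 (Y + EuclideanSpace.single 1 (1 : ℝ)) = φ 1 Y) :
    ∫ x in Icc (![0, 0, a] : Fin 3 → ℝ) ![1, 1, b],
        ∑ i : Fin 3, fderiv ℝ (φ i) (WithLp.toLp 2 x) (EuclideanSpace.single i (1 : ℝ)) =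
      (∫ q in Icc (0 : ℝ) 1 ×ˢ Icc (0 : ℝ) 1, φ 2 !₂[q.1, q.2, b]) -
        ∫ q in Icc (0 : ℝ) 1 ×ˢ Icc (0 : ℝ) 1, φ 2 !₂[q.1, q.2, a] := by
  set S : Set (EuclideanSpace ℝ (Fin 3)) := {Y | 0 < Y 2 ∧ Y 2 < 1} with hS
  have hSo : IsOpen S :=
    (isOpen_lt continuous_const (PiLp.continuous_apply 2 _ 2)).inter
      (isOpen_lt (PiLp.continuous_apply 2 _ 2) continuous_const)
  set L : (Fin 3 → ℝ) →L[ℝ] EuclideanSpace ℝ (Fin 3) :=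
    ((EuclideanSpace.equiv (Fin 3) ℝ).symm : (Fin 3 → ℝ) →L[ℝ] EuclideanSpace ℝ (Fin 3)) with hL
  have hLx : ∀ x, L x = WithLp.toLp 2 x := fun x => rfl
  set A : Fin 3 → ℝ := ![0, 0, a] with hA
  set B : Fin 3 → ℝ := ![1, 1, b] with hB
  have hAB : A ≤ B := by
    intro i; fin_cases i <;> simp [hA, hB, hab]
  have hbox : ∀ x ∈ Icc A B, WithLp.toLp 2 x ∈ S := by
    intro x hx
    rw [mem_Icc, Pi.le_def, Pi.le_def] at hx
    have h0' := hx.1 2; have h1' := hx.2 2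
    simp only [hA, hB] at h0' h1'
    refine ⟨?_, ?_⟩ <;> simp at h0' h1' ⊢ <;> linarith
  -- the hypotheses of the divergence theorem
  set f : Fin 3 → (Fin 3 → ℝ) → ℝ := fun i x => φ i (WithLp.toLp 2 x) with hf
  set f' : Fin 3 → (Fin 3 → ℝ) → (Fin 3 → ℝ) →L[ℝ] ℝ := fun i x =>
    (fderiv ℝ (φ i) (WithLp.toLp 2 x)).comp L with hf'
  have Hc : ∀ i, ContinuousOn (f i) (Icc A B) := fun i =>
    ((hφ i).continuousOn.comp (PiLp.continuous_toLp 2 _).continuousOn hbox)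
  have Hd : ∀ x ∈ (Set.pi univ fun i => Ioo (A i) (B i)) \ (∅ : Set (Fin 3 → ℝ)), ∀ i,
      HasFDerivAt (f i) (f' i x) x := by
    intro x hx i
    have hxS : WithLp.toLp 2 x ∈ S := by
      refine hbox x ?_
      have := hx.1
      rw [mem_univ_pi] at this
      exact ⟨fun j => (this j).1.le, fun j => (this j).2.le⟩
    have hd : DifferentiableAt ℝ (φ i) (WithLp.toLp 2 x) :=
      ((hφ i).differentiableOn one_ne_zero).differentiableAt (hSo.mem_nhds hxS)
    exact hd.hasFDerivAt.comp x L.hasFDerivAt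
  have hcontD : ∀ i, ContinuousOn (fun x => f' i x (Pi.single i 1)) (Icc A B) := by
    intro i
    have hc : ContinuousOn (fderiv ℝ (φ i)) S := (hφ i).continuousOn_fderiv_of_isOpen hSo le_rfl
    have := (hc.comp (PiLp.continuous_toLp 2 _).continuousOn hbox).clm_apply
      (continuousOn_const (c := L (Pi.single i 1)))
    simpa [hf'] using this
  have Hi : IntegrableOn (fun x => ∑ i, f' i x (Pi.single i 1)) (Icc A B) :=
    (continuousOn_finsetSum _ fun i _ => hcontD i).integrableOn_compact isCompact_Icc
  have key := integral_divergence_of_hasFDerivAt_off_countable' A B hAB f f' ∅ countable_empty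
    Hc Hd Hi
  -- the left-hand sides agree
  have hlhs : ∀ x, ∑ i, f' i x (Pi.single i 1) =
      ∑ i : Fin 3, fderiv ℝ (φ i) (WithLp.toLp 2 x) (EuclideanSpace.single i (1 : ℝ)) := by
    intro x
    refine Finset.sum_congr rfl fun i _ => ?_
    simp only [hf', ContinuousLinearMap.coe_comp, comp_apply, hLx, PiLp.toLp_single]
  simp_rw [hlhs] at key
  rw [key, Fin.sum_univ_three]
  -- the lateral faces cancel
  have hface0 : ∀ x : Fin 2 → ℝ, f 0 (Fin.insertNth 0 (B 0) x) = f 0 (Fin.insertNth 0 (A 0) x) := by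
    intro x
    simp only [hf]
    have : (WithLp.toLp 2 (Fin.insertNth 0 (B 0) x) : EuclideanSpace ℝ (Fin 3)) =
        WithLp.toLp 2 (Fin.insertNth 0 (A 0) x) + EuclideanSpace.single 0 (1 : ℝ) := by
      ext i
      fin_cases i <;> (simp [hA, hB]; try rfl)
    rw [this, h0]
  have hface1 : ∀ x : Fin 2 → ℝ, f 1 (Fin.insertNth 1 (B 1) x) = f 1 (Fin.insertNth 1 (A 1) x) := by
    intro x
    simp only [hf]
    have : (WithLp.toLp 2 (Fin.insertNth 1 (B 1) x) : EuclideanSpace ℝ (Fin 3)) =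
        WithLp.toLp 2 (Fin.insertNth 1 (A 1) x) + EuclideanSpace.single 1 (1 : ℝ) := by
      ext i
      fin_cases i <;> (simp [hA, hB]; try rfl)
    rw [this, h1]
  simp_rw [hface0, hface1, sub_self, zero_add]
  -- the horizontal faces
  have hsq : Icc (A ∘ Fin.succAbove 2) (B ∘ Fin.succAbove 2) = Icc (0 : Fin 2 → ℝ) 1 := by
    have hA' : A ∘ Fin.succAbove 2 = (0 : Fin 2 → ℝ) := by
      funext j; fin_cases j <;> rfl
    have hB' : B ∘ Fin.succAbove 2 = (1 : Fin 2 → ℝ) := by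
      funext j; fin_cases j <;> rfl
    rw [hA', hB']
  rw [hsq, lerayCapping_setIntegral_fin_two, lerayCapping_setIntegral_fin_two]
  have hpt : ∀ (t : ℝ) (q : ℝ × ℝ),
      (WithLp.toLp 2 (Fin.insertNth (2 : Fin 3) t ![q.1, q.2]) : EuclideanSpace ℝ (Fin 3)) =
        !₂[q.1, q.2, t] := by
    intro t q
    ext i
    fin_cases i <;> rfl
  simp only [hf, hA, hB]
  simp_rw [show (![0, 0, a] : Fin 3 → ℝ) 2 = a by simp, show (![1, 1, b] : Fin 3 → ℝ) 2 = b by simp, hpt]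

/-- Registered tools stub of `stub_lerayCapping` (line Sketch of crux `DyadicRealisation`): the
conjunction of the lemmas of this file. [folklore] -/
theorem stub_lerayCappingTools4 :
    (∀ (G : EuclideanSpace ℝ (Fin 3) → EuclideanSpace ℝ (Fin 3)), (∀ Y : EuclideanSpace ℝ (Fin 3), G (Y + EuclideanSpace.single 0 (1 : ℝ)) = G Y) →
      (∀ Y : EuclideanSpace ℝ (Fin 3), G (Y + EuclideanSpace.single 1 (1 : ℝ)) = G Y) → ∀ Y : EuclideanSpace ℝ (Fin 3),
      G (Literature.Analysis.FunctionSpaces.Torus.repr (Literature.Analysis.FunctionSpaces.Torus.proj Y)) = G (Y - (⌊Y 2⌋ : ℝ) • EuclideanSpace.single 2 (1 : ℝ))) ∧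
    (∀ (G : EuclideanSpace ℝ (Fin 3) → EuclideanSpace ℝ (Fin 3)), (∀ Y : EuclideanSpace ℝ (Fin 3), G (Y + EuclideanSpace.single 0 (1 : ℝ)) = G Y) →
      (∀ Y : EuclideanSpace ℝ (Fin 3), G (Y + EuclideanSpace.single 1 (1 : ℝ)) = G Y) → ∀ Y : EuclideanSpace ℝ (Fin 3),
      (0 ≤ Y 2 → Y 2 < 1 → G (Literature.Analysis.FunctionSpaces.Torus.repr (Literature.Analysis.FunctionSpaces.Torus.proj Y)) = G Y) ∧
      (-1 ≤ Y 2 → Y 2 < 0 → G (Literature.Analysis.FunctionSpaces.Torus.repr (Literature.Analysis.FunctionSpaces.Torus.proj Y)) = G (Y + EuclideanSpace.single 2 (1 : ℝ)))) ∧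
    (∀ (G : EuclideanSpace ℝ (Fin 3) → EuclideanSpace ℝ (Fin 3)), ContDiff ℝ ((⊤ : ℕ∞) : WithTop ℕ∞) G →
      (∀ Y : EuclideanSpace ℝ (Fin 3), G (Y + EuclideanSpace.single 0 (1 : ℝ)) = G Y) →
      (∀ Y : EuclideanSpace ℝ (Fin 3), G (Y + EuclideanSpace.single 1 (1 : ℝ)) = G Y) →
      ∀ δ : ℝ, 0 < δ → (∀ Y : EuclideanSpace ℝ (Fin 3), (Y 2 ≤ δ ∨ 1 - δ ≤ Y 2) → G Y = 0) →
      ContDiff ℝ ((⊤ : ℕ∞) : WithTop ℕ∞) (fun Y : EuclideanSpace ℝ (Fin 3) => G (Literature.Analysis.FunctionSpaces.Torus.repr (Literature.Analysis.FunctionSpaces.Torus.proj Y)))) ∧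
    (∀ (h : UnitAddTorus (Fin 3) → EuclideanSpace ℝ (Fin 3)), MeasureTheory.Integrable h →
      (∀ j : Fin 3, ∫ x, h x j = 0) → ∫ x, h x = 0) ∧
    (∀ {F : Type*} [NormedAddCommGroup F] [NormedSpace ℝ F] (G : EuclideanSpace ℝ (Fin 3) → F) (a b : ℝ), 0 ≤ a → b ≤ 1 →
      (∀ Y : EuclideanSpace ℝ (Fin 3), 0 ≤ Y 2 → Y 2 ≤ 1 → (Y 2 < a ∨ b < Y 2) → G Y = 0) →
      ∫ Y in Literature.Analysis.FunctionSpaces.Torus.unitCube (Fin 3), G Y =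
        ∫ x in Set.Icc (![0, 0, a] : Fin 3 → ℝ) ![1, 1, b], G (WithLp.toLp 2 x)) ∧
    (∀ {F : Type*} [NormedAddCommGroup F] [NormedSpace ℝ F] (K : (Fin 2 → ℝ) → F),
      ∫ x in Set.Icc (0 : Fin 2 → ℝ) 1, K x =
        ∫ q in Set.Icc (0 : ℝ) 1 ×ˢ Set.Icc (0 : ℝ) 1, K ![q.1, q.2]) ∧
    (∀ (φ : Fin 3 → EuclideanSpace ℝ (Fin 3) → ℝ) (a b : ℝ), 0 < a → a ≤ b → b < 1 →
      (∀ i, ContDiffOn ℝ 1 (φ i) {Y : EuclideanSpace ℝ (Fin 3) | 0 < Y 2 ∧ Y 2 < 1}) →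
      (∀ Y : EuclideanSpace ℝ (Fin 3), φ 0 (Y + EuclideanSpace.single 0 (1 : ℝ)) = φ 0 Y) →
      (∀ Y : EuclideanSpace ℝ (Fin 3), φ 1 (Y + EuclideanSpace.single 1 (1 : ℝ)) = φ 1 Y) →
      ∫ x in Set.Icc (![0, 0, a] : Fin 3 → ℝ) ![1, 1, b],
          ∑ i : Fin 3, fderiv ℝ (φ i) (WithLp.toLp 2 x) (EuclideanSpace.single i (1 : ℝ)) =
        (∫ q in Set.Icc (0 : ℝ) 1 ×ˢ Set.Icc (0 : ℝ) 1, φ 2 !₂[q.1, q.2, b]) -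
          ∫ q in Set.Icc (0 : ℝ) 1 ×ˢ Set.Icc (0 : ℝ) 1, φ 2 !₂[q.1, q.2, a]) :=
  ⟨lerayCapping_comp_repr_proj, lerayCapping_comp_repr_proj_layers,
    lerayCapping_contDiff_comp_repr_proj, lerayCapping_integral_eq_zero_of_forall_apply,
    fun G a b ha hb hz => lerayCapping_setIntegral_unitCube_eq_box G a b ha hb hz,
    fun K => lerayCapping_setIntegral_fin_two K, lerayCapping_box_divergence⟩

end Summit.AnomalousDissipation.AnomalousDissipation.Theorems
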